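import Summits.HodgeConjecture.HodgeConjecture.Theorems.VHCAbelianSchemesRoadSecantAnchorInhabitedPrime
import HarnessLib

/-!
# Road b02 (`VHCAbelianSchemesRoad`) — THE SECANT-ANCHOR DATA INSIDE REGIME 2, RE-TYPED AT C″: the consumers of the twice-repaired
# family-supply hypothesis `SecantAnchorWeilPencilSupply''` (`= Supply′ +` compatibility `ψ₀^*(q^*h) = d·q^*h`)

research route conditional on HC_CM; not a corollary; Q11.4-sentence-2 already refuted in dim ≥ 3.

ring2-b03 gen 86, director-hodge g9 R10.3 (2) «R1 → ring2-b03 FIRST» after refute-markman gen 2's report `REFUTE-MARKMAN-G2.md` (sha16 007f279b3d5d21ed;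
Lean slice p556631 `…/Negative/SecantAnchorWeilPencilSupplyPrimeReducesToLefschetz.lean`): `SecantAnchorWeilPencilSupply'` (p544959 §2) is FALSE AS
TYPED at paper level (class refuted-misstated) — witness `Y = P = J × Ĵ`, `End J = ℤ`, `q = 𝟙`, `ψ₀ = φ_d`, the PRODUCT principal polarisation
`h = pr₁^*θ + pr₂^*θ̂` (ample, hyperbolic, but `φ_d^*h = θ₁ + d²θ₂ ≠ d·h`), `γ` any non-zero rational Weil class: Mumford–Tate `GSp(H¹J) ⊗ 1` on every
pencil keeping `γ` and `h` Hodge, so `γ ∉ exceptionalPencilClassesThrough 6 3 Y.X h`. The repair is the COMPATIBILITY binder; the re-typed hypothesis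
`SecantAnchorWeilPencilSupply''` is `VHCAbelianSchemesRoadSecantAnchorInhabitedDefs` §3 (appended by this generation). This companion file carries:

* §1 `secantAnchorWeilPencilSupply''_of_supply'` — `Supply′ ⟹ Supply″` (the re-typed hypothesis is WEAKER: one more binder, same conclusion), so
  everything landed «modulo `Supply′`» holds a fortiori modulo `Supply″`-AND-`Supply′`; the converse is exactly what the refuter's witness denies.
* §2 THE POINTED CONSUMERS AT A COMPATIBLE ANCHOR. The lineage's anchor source `HasSecantCarrierWeilAnchor C AdmTw d` (b02's L1) does NOT record the
  compatibility of `h` with `ψ₀`, so its four `…_of_supply'` consumers (`VHCAbelianSchemesRoadSecantAnchorInhabitedPrime` §2) cannot be re-keyed to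
  `Supply″` from L1 alone. They are re-typed here on EXPLICIT anchor data carrying the compatibility
  (`exists_servedPencil_regimeTwo_of_compatibleAnchor_of_supply''`, `mem_exceptionalPencilClassesThrough_of_compatibleAnchor_of_supply''`) and on the
  inline «compatible anchor» existential (`not_forall_cell_not_hasServedFibre_63_secant_of_compatibleAnchor_of_supply''`) — which lane W1's PINNED
  anchors discharge by theorem (`h = h_Y(θ)`: `Literature.AlgebraicGeometry.Markman2025.complexBetti_map_descendedWeilOperator_secantPolarizationClass`,
  level factor `n²` inside `ψ_Y² = −n²d`; director R10.3 (2) R2, ring2-b03x). Nothing of `…InhabitedPrime` is edited; its `…_of_supply'` theorems stay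
  kernel-correct statements modulo a paper-refuted hypothesis.

Nothing here says `Supply″`, any carrier ∕ cell ∕ rung ∕ crux statement, VHC, `HC_AV` or HC holds.
References: [cite: vanGeemen1994HodgeAV, Thm. 4.11, Lemma 5.2 and 5.3–5.5] [cite: Markman2025SecantWeil, Thm. 1.4.1, Cor. 4.0.4, §1.5 and §3.2 Cor. 3.2.3]
[cite: Bloch1972Semiregularity, Remark (7.5)] [cite: Deligne1982HodgeCycles, §4, proof of Thm. 4.8].
-/

noncomputable section

open CategoryTheory CategoryTheory.Limits AlgebraicGeometry Topology

-- the cell's namespace repeats the summit name (`Summit.HodgeConjecture.HodgeConjecture…`), as in every `Ring2*` file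
set_option linter.dupNamespace false

namespace Summit.HodgeConjecture.HodgeConjecture.Ring2.SemiregularRepresentatives

open Literature.AlgebraicGeometry Literature.AlgebraicGeometry.Motives Literature.AlgebraicGeometry.Modules
open Literature.AlgebraicGeometry.HodgeTheory
open Literature.AlgebraicTopology.SingularHomology
open Literature.Barriers.HodgeConjecture (divisorClassesSpan)
open Summit.Ventures.HSemireg (ObjClass)

/-! ## §1 `Supply′ ⟹ Supply″` -/

/-- **The re-typed hypothesis is weaker**: `SecantAnchorWeilPencilSupply' → SecantAnchorWeilPencilSupply''` (drop the compatibility binder).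
[cite: vanGeemen1994HodgeAV, 5.3–5.5] -/
theorem secantAnchorWeilPencilSupply''_of_supply' (hsup : SecantAnchorWeilPencilSupply') : SecantAnchorWeilPencilSupply'' :=
  fun d P Y ψ₀ q h γ hd hP hY hψ hq hpol hhyp _ hγQ hγoff hγW hγH ↦ hsup d P Y ψ₀ q h γ hd hP hY hψ hq hpol hhyp hγQ hγoff hγW hγH

/-! ## §2 The pointed consumers at a compatible anchor -/

section Compatible

variable {C : ChernCharacterBetti}

/-- **At a COMPATIBLE secant anchor the served class lies on an exceptional cell-shaped pencil, modulo `Supply″`**: anchor data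
`(P, Y, ψ₀, q, h, γ)` with every binder of `HasSecantCarrierWeilAnchor`, `γ` of type `(3,3)`, AND `ψ₀^*(q^*h) = d·q^*h` give
`γ ∈ exceptionalPencilClassesThrough 6 3 Y.X h`. [cite: vanGeemen1994HodgeAV, Thm. 4.11 and 5.3–5.5] [cite: Markman2025SecantWeil, Thm. 1.4.1 and §1.5] -/
theorem mem_exceptionalPencilClassesThrough_of_compatibleAnchor_of_supply'' {d : ℕ} {P Y : AbelianVariety ℂ} {ψ₀ : P ⟶ P} {q : P ⟶ Y}
    {h : complexBetti Y.X 2} {γ : complexBetti Y.X (2 * 3)} (hd : 0 < d) (hP : P.dim = 6) (hY : Y.dim = 6) (hψ : ψ₀ ≫ ψ₀ = -(d • 𝟙 P))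
    (hq : ∀ k : ℕ, Function.Bijective (complexBetti.map q.hom.hom.hom k)) (hpol : IsPolarizationClass 6 Y.X h)
    (hhyp : IsHyperbolicWeilType P ψ₀ 3 (complexBetti.map q.hom.hom.hom 2 h))
    (hcompat : complexBetti.map ψ₀.hom.hom.hom 2 (complexBetti.map q.hom.hom.hom 2 h) = (d : ℂ) • complexBetti.map q.hom.hom.hom 2 h)
    (hγQ : IsRationalClass γ) (hγoff : γ ∉ (ℂ ∙ cupPowTwo h 3))
    (hγW : complexBetti.map q.hom.hom.hom (2 * 3) γ ∈ weilClassesOf P ψ₀ 3 d) (hγH : IsOfHodgeType 6 Y.X (2 * 3) 3 3 γ)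
    (hsup : SecantAnchorWeilPencilSupply'') : γ ∈ exceptionalPencilClassesThrough 6 3 Y.X h :=
  hsup d P Y ψ₀ q h γ hd hP hY hψ hq hpol hhyp hcompat hγQ hγoff hγW hγH

/-- **INSIDE REGIME 2 AT A COMPATIBLE ANCHOR, MODULO `Supply″`** (the pointed twin of
`exists_servedPencil_regimeTwo_of_hasSecantCarrierWeilAnchor_of_supply'`): from compatible anchor data with `γ` rational, ALGEBRAIC, of type `(3,3)`,
off `ℂ·h³`, pulled back into the Weil plane, and the every-copy memberships `e^*h ∈ secantAnchorSixfold C X'`, `e^*γ ∈ secantServedClasses C X' (e^*h)`,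
the supplied exceptional cell-shaped pencil satisfies every binder of the cell `(6,3)` of K-SR♭∃, its class is fibrewise rational `(3,3)`, algebraic at
the anchor fibre and not algebraic-Lefschetz on every fibre, and the anchor fibre is SERVED. [cite: vanGeemen1994HodgeAV, Thm. 4.11 and 5.3–5.5]
[cite: Markman2025SecantWeil, Thm. 1.4.1, Cor. 4.0.4 and §1.5] [cite: Bloch1972Semiregularity, Remark (7.5)] -/
theorem exists_servedPencil_regimeTwo_of_compatibleAnchor_of_supply'' {d : ℕ} {P Y : AbelianVariety ℂ} {ψ₀ : P ⟶ P} {q : P ⟶ Y}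
    {h : complexBetti Y.X 2} {γ : complexBetti Y.X (2 * 3)} (hd : 0 < d) (hP : P.dim = 6) (hY : Y.dim = 6) (hψ : ψ₀ ≫ ψ₀ = -(d • 𝟙 P))
    (hq : ∀ k : ℕ, Function.Bijective (complexBetti.map q.hom.hom.hom k)) (hpol : IsPolarizationClass 6 Y.X h)
    (hhyp : IsHyperbolicWeilType P ψ₀ 3 (complexBetti.map q.hom.hom.hom 2 h))
    (hcompat : complexBetti.map ψ₀.hom.hom.hom 2 (complexBetti.map q.hom.hom.hom 2 h) = (d : ℂ) • complexBetti.map q.hom.hom.hom 2 h)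
    (hγQ : IsRationalClass γ) (hγalg : γ ∈ algebraicClasses Y.X 3) (hγH : IsOfHodgeType 6 Y.X (2 * 3) 3 3 γ) (hγoff : γ ∉ (ℂ ∙ cupPowTwo h 3))
    (hγW : complexBetti.map q.hom.hom.hom (2 * 3) γ ∈ weilClassesOf P ψ₀ 3 d)
    (hcopy : ∀ (X' : SchemeOver ℂ) (e : X' ≅ Y.X),
      complexBetti.map e.hom 2 h ∈ secantAnchorSixfold C X' ∧
        complexBetti.map e.hom (2 * 3) γ ∈ secantServedClasses C X' (complexBetti.map e.hom 2 h))
    (hsup : SecantAnchorWeilPencilSupply'') :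
    ∃ (𝒳 S : SchemeOver ℂ) (f : 𝒳 ⟶ S) (W : complexBetti 𝒳 (2 * 3)) (s₀ : ComplexPoints S),
      IsSmoothProjectiveFamily f 6 ∧ IsQuasiProjectiveOver 𝒳 ∧ IrreducibleSpace S.left ∧ IsAffine S.left ∧
      AlgebraicGeometry.Smooth S.hom ∧ topologicalKrullDim S.left = 1 ∧
      (∀ s : ComplexPoints S, ∃ A' : AbelianVariety ℂ, A'.dim = 6 ∧ Nonempty (A'.X ≅ fiberOver f s)) ∧
      (∃ e : S ⟶ 𝒳, e ≫ f = 𝟙 S) ∧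
      (∀ s : ComplexPoints S, IsRationalClass (complexBetti.map (fiberι f s) (2 * 3) W) ∧
        IsOfHodgeType 6 (fiberOver f s) (2 * 3) 3 3 (complexBetti.map (fiberι f s) (2 * 3) W)) ∧
      complexBetti.map (fiberι f s₀) (2 * 3) W ∈ algebraicClasses (fiberOver f s₀) 3 ∧
      (¬ ∀ s : ComplexPoints S,
        complexBetti.map (fiberι f s) (2 * 3) W ∈ algebraicClasses (fiberOver f s) 3 ∧
        complexBetti.map (fiberι f s) (2 * 3) W ∈ divisorClassesSpan (fiberOver f s) 6 3) ∧
      HasServedFibre 6 3 (fun X θ => θ ∈ secantAnchorSixfold C X) (secantServedClasses C) f W := by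
  obtain ⟨𝒳, S, f, sₐ, e, Θ, W, hf, h𝒳, hirr, haff, hsm, hdim, hab, hsec, hΘQ, hΘH, hW, hΘ, hWa, hexc⟩ :=
    hsup d P Y ψ₀ q h γ hd hP hY hψ hq hpol hhyp hcompat hγQ hγoff hγW hγH
  refine ⟨𝒳, S, f, W, sₐ, hf, h𝒳, hirr, haff, hsm, hdim, hab, hsec, hW, ?_, hexc, ?_⟩
  · rw [hWa]
    exact (mem_algebraicClasses_map_iff_of_iso e.symm).2 hγalg
  · refine ⟨sₐ, Θ, hΘQ, hΘH, ?_, ?_⟩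
    · rw [hΘ]
      exact (hcopy _ e.symm).1
    · rw [hΘ, hWa]
      exact (hcopy _ e.symm).2

/-- **THE PENCIL-LEVEL C2 WITNESS INSIDE THE CELL'S BINDERS, AT C″** (the `¬ ∀`-form with every binder of `LefAtExceptionalRegimeAt _ 6 3` displayed):
modulo ONE COMPATIBLE ANCHOR (the inline existential: `HasSecantCarrierWeilAnchor`'s data for `AdmTw` with `γ` algebraic of type `(3,3)` and
`ψ₀^*(q^*h) = d·q^*h` — discharged at lane W1's pinned anchors by `complexBetti_map_descendedWeilOperator_secantPolarizationClass`) and `Supply″`, it is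
NOT the case that every cell-shaped abelian-sixfold pencil in regime 2 has no served fibre for the secant data.
[cite: Markman2025SecantWeil, Thm. 1.4.1 and §1.5] [cite: vanGeemen1994HodgeAV, Thm. 4.11 and 5.3–5.5] [cite: Bloch1972Semiregularity, Remark (7.5)] -/
theorem not_forall_cell_not_hasServedFibre_63_secant_of_compatibleAnchor_of_supply''
    (hanchor : ∃ (d : ℕ) (P Y : AbelianVariety ℂ) (ψ₀ : P ⟶ P) (q : P ⟶ Y) (h : complexBetti Y.X 2) (γ : complexBetti Y.X (2 * 3)),
      0 < d ∧ P.dim = 6 ∧ Y.dim = 6 ∧ ψ₀ ≫ ψ₀ = -(d • 𝟙 P) ∧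
      (∀ k : ℕ, Function.Bijective (complexBetti.map q.hom.hom.hom k)) ∧ IsPolarizationClass 6 Y.X h ∧
      IsHyperbolicWeilType P ψ₀ 3 (complexBetti.map q.hom.hom.hom 2 h) ∧
      complexBetti.map ψ₀.hom.hom.hom 2 (complexBetti.map q.hom.hom.hom 2 h) = (d : ℂ) • complexBetti.map q.hom.hom.hom 2 h ∧
      IsRationalClass γ ∧ γ ∈ algebraicClasses Y.X 3 ∧ IsOfHodgeType 6 Y.X (2 * 3) 3 3 γ ∧ γ ∉ (ℂ ∙ cupPowTwo h 3) ∧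
      complexBetti.map q.hom.hom.hom (2 * 3) γ ∈ weilClassesOf P ψ₀ 3 d ∧
      ∀ (X' : SchemeOver ℂ) (e : X' ≅ Y.X),
        complexBetti.map e.hom 2 h ∈ secantAnchorSixfold C X' ∧
          complexBetti.map e.hom (2 * 3) γ ∈ secantServedClasses C X' (complexBetti.map e.hom 2 h))
    (hsup : SecantAnchorWeilPencilSupply'') :
    ¬ ∀ ⦃𝒳 S : SchemeOver ℂ⦄ (f : 𝒳 ⟶ S), IsSmoothProjectiveFamily f 6 → IsQuasiProjectiveOver 𝒳 →
      IrreducibleSpace S.left → IsAffine S.left → AlgebraicGeometry.Smooth S.hom → topologicalKrullDim S.left = 1 →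
      (∀ s : ComplexPoints S, ∃ A' : AbelianVariety ℂ, A'.dim = 6 ∧ Nonempty (A'.X ≅ fiberOver f s)) →
      (∃ e : S ⟶ 𝒳, e ≫ f = 𝟙 S) →
      ∀ (W : complexBetti 𝒳 (2 * 3)),
        (∀ s : ComplexPoints S, IsRationalClass (complexBetti.map (fiberι f s) (2 * 3) W) ∧
          IsOfHodgeType 6 (fiberOver f s) (2 * 3) 3 3 (complexBetti.map (fiberι f s) (2 * 3) W)) →
        ∀ s₀ : ComplexPoints S,
          complexBetti.map (fiberι f s₀) (2 * 3) W ∈ algebraicClasses (fiberOver f s₀) 3 →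
          (¬ ∀ s : ComplexPoints S,
            complexBetti.map (fiberι f s) (2 * 3) W ∈ algebraicClasses (fiberOver f s) 3 ∧
            complexBetti.map (fiberι f s) (2 * 3) W ∈ divisorClassesSpan (fiberOver f s) 6 3) →
          ¬ HasServedFibre 6 3 (fun X θ => θ ∈ secantAnchorSixfold C X) (secantServedClasses C) f W := by
  intro hnone
  obtain ⟨d, P, Y, ψ₀, q, h, γ, hd, hP, hY, hψ, hq, hpol, hhyp, hcompat, hγQ, hγalg, hγH, hγoff, hγW, hcopy⟩ := hanchor
  obtain ⟨𝒳, S, f, W, s₀, hf, h𝒳, hirr, haff, hsm, hdim, hab, hsec, hW, halg, hexc, hserved⟩ :=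
    exists_servedPencil_regimeTwo_of_compatibleAnchor_of_supply'' hd hP hY hψ hq hpol hhyp hcompat hγQ hγalg hγH hγoff hγW hcopy hsup
  exact hnone f hf h𝒳 hirr haff hsm hdim hab hsec W hW s₀ halg hexc hserved

end Compatible

end Summit.HodgeConjecture.HodgeConjecture.Ring2.SemiregularRepresentatives

end
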